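import Literature.NumberTheory.EllipticCurves.HeegnerModuleIndex
import Literature.NumberTheory.EllipticCurves.IwasawaDualModule
import Literature.NumberTheory.EllipticCurves.IwasawaSelmerProofs
import HarnessLib

/-!
# The levels `H¹(K_n, E[p^k])` of `𝔖_p(K_∞)`: `ψ = conj_γ − 1`, its nilpotence, and the transport of
# the truncated `ℤ_p⟦T⟧`-action along `p_*`, `res`, `conj` (proofs only; input of
# `LambdaAdicSelmerDataProofs.lean`, the discharge of `WeierstrassCurve.lambdaAdicSelmerData_exists_unique`)

Topic `NumberTheory/EllipticCurves`; sibling of `HeegnerModuleIndex.lean` (statement file untouched).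
Seat `bsd-littype-05` (literature-prover, re-seat g3; `ledger fact claim` on
`WeierstrassCurve.lambdaAdicSelmerData_exists_unique`). Nothing is defined or asserted: the file
proves the levelwise algebra behind Perrin-Riou's compact `Λ`-module `𝔖_p(K_∞) = lim←_n S_p(E/K_n)`
(Bull. SMF 115 (1987) §0 p. 402: "des `ℤ_p`-modules compacts … les homomorphismes de transition sont
induits par la corestriction") over the tree's truncated evaluation `IwasawaDual.evalT` (Lang,
*Cyclotomic Fields*, Ch. 5 §1 Thm. 1.1; Greenberg LNM 1716 §1 p. 60: "`Γ` acts naturally on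
`H¹(F_∞, E[p^∞])` … every element of which is killed by `Tⁿ` for some `n`. Thus … a `Λ`-module").
Throughout, an endomorphism `ψ ∈ End H¹(H, E[p^k])` "is `conj_γ − 1`" when `ψ y = conj_γ y − y` for all
`y` (hypothesis `hψ`; the tree's `conjH1 H (E[p^k]) γ` is an additive map, the ring `AddMonoid.End` is
where `IwasawaDual.evalT` takes its argument — no abbreviation is introduced, statements quantify
over such `ψ`).

* Part 1 (one level `H¹(H, E[p^k])`, `H ⊴ Γ_K`, any field): `p^k` kills the level
  (`pow_nsmul_eq_zero`); `θ^m = conj_{γ^m}` for `θ` "`= conj_γ`" (`conjH1_pow_apply`); hence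
  `ψ^{k pⁿ} = 0` when `γ^{pⁿ} ∈ H` (`psi_pow_apply_eq_zero`: inner automorphisms act trivially,
  `conjH1_of_mem_holds`, and `IwasawaDual.pow_mul_prime_pow_apply_eq_zero`).
* Part 2 (any abelian groups): an additive `Φ` with `Φ ψ_A = ψ_B Φ` transports the truncated action
  `f ⋆ a = Σ_{i<N} coeff_i(f) ψ^i a = evalT p ψ N k f id a` (`map_evalT_id`); `ψ^i` commutes with it
  (`pow_apply_evalT_id`); multiplicativity on elements killed by `ψ^N`, `p^k` (`evalT_id_mul`, from
  `IwasawaDual.evalT_mul`); congruence in `f` below the truncation (`evalT_congr_left`); finite sums.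
* Part 3 (levels of a number field): Selmer conditions are `conj`-stable
  (`conjH1_mem_selmerTorsionOver`, hence `psi_pow_mem_…`, `evalT_mem_…`); `p_*`, `res` and `conj_σ`
  (`σ` commuting with `γ`) commute with `ψ` (`reduceTorsionH1_psi`, `resOfLe_psi`,
  `conjH1_psi_of_commute`); `γ^{pⁿ} ∈ Gal(K̄/K_n)` (`pow_mem_layerSubgroup`, local copy).
No definition, no named fact, no `instance`, no notation.

## References
* [PerrinRiou1987BSMF] B. Perrin-Riou, Bull. SMF 115 (1987), §0 pp. 401–402.
* [GreenbergLNM1716] R. Greenberg, LNM 1716 (1999), §1 (p. 60). [Lang1990] Ch. 5 §1 Thm. 1.1.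
* [NeukirchSchmidtWingberg2008] I.§5 (functoriality, conjugation); [SerreLocalFields1979] VII.§5 Prop. 3.
* [SilvermanAEC2009] VIII.§2. Tree: `IwasawaDualModule.lean`, `IwasawaSelmerProofs.lean`,
  `Kato2004/IwasawaCohomologyExistsProofs.lean` (the same pattern for `𝐇¹_Γ(T_pW)`).
-/

set_option autoImplicit false

noncomputable section

open scoped Classical

open Literature.NumberTheory.EllipticCurves Literature.NumberTheory.EllipticCurves.IwasawaDual
  Literature.NumberTheory.GaloisRepresentations PowerSeries

universe u

namespace WeierstrassCurve

namespace LambdaAdicSelmerDataExists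

/-! ## Part 1. One level `H¹(H, E[p^k])`: torsion, `θ = conj_γ`, `ψ = θ − 1` and its nilpotence -/

section Level

variable {K : Type u} [Field K] (V : WeierstrassCurve K) (p : ℕ) [Fact p.Prime]
  (H : Subgroup (Field.absoluteGaloisGroup K)) [H.Normal] (γ : Field.absoluteGaloisGroup K)

omit [Fact p.Prime] [H.Normal] in
/-- `p^k` kills `H¹(H, E[p^k])` (a class is represented by a cocycle with values in `E[p^k]`).
[cite: SilvermanAEC2009, VIII.§2 (cohomology of the finite module `E[m]`)] -/
theorem pow_nsmul_eq_zero (k : ℕ) (y : V.torsionH1Over ((p : ℤ) ^ k) H) : p ^ k • y = 0 := by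
  obtain ⟨φ, rfl⟩ := oneCocycleClass_surjective (discreteTopRep H (geomTorsion V ((p : ℤ) ^ k))) y
  exact nsmul_oneCocycleClass_eq_zero φ (p ^ k) fun g ↦ Subtype.ext (by
    rw [AddSubmonoidClass.coe_nsmul, ← natCast_zsmul, Nat.cast_pow]
    exact (mem_geomTorsion_iff V _ _).1 (φ.1 g).2)

variable {V p H γ}

omit [Fact p.Prime] in
/-- `θ^m = conj_{γ^m}` on `H¹(H, E[p^k])` for `θ = conj_γ` (`conjH1_mul`, `conjH1_one`).
[cite: NeukirchSchmidtWingberg2008, I.§5] -/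
theorem conjH1_pow_apply {k : ℕ} {θ : AddMonoid.End (V.torsionH1Over ((p : ℤ) ^ k) H)}
    (hθ : ∀ y, θ y = Literature.NumberTheory.EllipticCurves.conjH1 H (geomTorsion V ((p : ℤ) ^ k)) γ y) (m : ℕ)
    (y : V.torsionH1Over ((p : ℤ) ^ k) H) : (θ ^ m) y = Literature.NumberTheory.EllipticCurves.conjH1 H (geomTorsion V ((p : ℤ) ^ k)) (γ ^ m) y := by
  induction m generalizing y with
  | zero =>
    rw [pow_zero, pow_zero, Literature.NumberTheory.EllipticCurves.conjH1_one_holds H (geomTorsion V ((p : ℤ) ^ k))]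
    rfl
  | succ m ih =>
    rw [pow_succ, AddMonoid.End.coe_mul, Function.comp_apply, hθ, ih, pow_succ,
      Literature.NumberTheory.EllipticCurves.conjH1_mul_holds H (geomTorsion V ((p : ℤ) ^ k)) (γ ^ m) γ]
    rfl

/-- **Nilpotence of `ψ = conj_γ − 1`**: `ψ^{k·pⁿ} = 0` on `H¹(H, E[p^k])` when `γ^{pⁿ} ∈ H` (inner
automorphisms act trivially, `conjH1_of_mem_holds`; `p^k` kills the level;
`IwasawaDual.pow_mul_prime_pow_apply_eq_zero`). [cite: GreenbergLNM1716, §1 (p. 60)]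
[cite: SerreLocalFields1979, VII.§5 Prop. 3] -/
theorem psi_pow_apply_eq_zero {k : ℕ} {ψ : AddMonoid.End (V.torsionH1Over ((p : ℤ) ^ k) H)}
    (hψ : ∀ y, ψ y = Literature.NumberTheory.EllipticCurves.conjH1 H (geomTorsion V ((p : ℤ) ^ k)) γ y - y) {n : ℕ} (hn : γ ^ p ^ n ∈ H)
    (y : V.torsionH1Over ((p : ℤ) ^ k) H) : (ψ ^ (k * p ^ n)) y = 0 := by
  have hθ : ∀ y, (ψ + 1) y = Literature.NumberTheory.EllipticCurves.conjH1 H (geomTorsion V ((p : ℤ) ^ k)) γ y := fun y ↦ by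
    change ψ y + y = _
    rw [hψ, sub_add_cancel]
  have h := pow_mul_prime_pow_apply_eq_zero (Fact.out : p.Prime) (ψ + 1) n
    ((conjH1_pow_apply hθ (p ^ n) y).trans
      (by rw [Literature.NumberTheory.EllipticCurves.conjH1_of_mem_holds H (geomTorsion V ((p : ℤ) ^ k)) hn]; rfl))
    (pow_nsmul_eq_zero V p H k y)
  rwa [add_sub_cancel_right] at h

end Level

/-! ## Part 2. Transport of the truncated evaluation along additive maps commuting with `ψ` -/

section Transport

variable {A B : Type*} [AddCommGroup A] [AddCommGroup B] {p : ℕ} [Fact p.Prime]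

/-- An additive map intertwining `ψ_A`, `ψ_B` intertwines their powers. [cite: Lang1990, Ch. 5 §1] -/
theorem map_pow_apply (ψA : AddMonoid.End A) (ψB : AddMonoid.End B) (Φ : A →+ B)
    (hΦ : ∀ a, Φ (ψA a) = ψB (Φ a)) (i : ℕ) (a : A) : Φ ((ψA ^ i) a) = (ψB ^ i) (Φ a) := by
  induction i generalizing a with
  | zero => rfl
  | succ i ih =>
    rw [pow_succ, pow_succ, AddMonoid.End.coe_mul, AddMonoid.End.coe_mul, Function.comp_apply,
      Function.comp_apply, ih, hΦ]

/-- **Transport of the truncated action**: an additive map `Φ` with `Φ ∘ ψ_A = ψ_B ∘ Φ` satisfies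
`Φ (f ⋆ a) = f ⋆ Φ a` for the truncated evaluation `f ⋆ a = Σ_{i<N} coeff_i(f) ψ^i a`
(`IwasawaDual.evalT … f id a`). [cite: Lang1990, Ch. 5 §1] -/
theorem map_evalT_id (ψA : AddMonoid.End A) (ψB : AddMonoid.End B) (Φ : A →+ B)
    (hΦ : ∀ a, Φ (ψA a) = ψB (Φ a)) (N k : ℕ) (f : PowerSeries ℤ_[p]) (a : A) :
    Φ (evalT p ψA N k f (AddMonoidHom.id A) a) = evalT p ψB N k f (AddMonoidHom.id B) (Φ a) := by
  simp only [evalT_def, map_sum, AddMonoidHom.id_apply, zpT_def, map_nsmul, map_pow_apply ψA ψB Φ hΦ]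

/-- `ψ^i` commutes with the truncated evaluation (a polynomial in `ψ`). [cite: Lang1990, Ch. 5 §1] -/
theorem pow_apply_evalT_id (ψ : AddMonoid.End A) (i N k : ℕ) (f : PowerSeries ℤ_[p]) (a : A) :
    (ψ ^ i) (evalT p ψ N k f (AddMonoidHom.id A) a) = evalT p ψ N k f (AddMonoidHom.id A) ((ψ ^ i) a) :=
  map_evalT_id ψ ψ (ψ ^ i) (fun a ↦ by
    change (ψ ^ i * ψ) a = (ψ * ψ ^ i) a
    rw [← pow_succ, ← pow_succ']) N k f a

/-- **Multiplicativity of the truncated action on elements**: `(f g) ⋆ a = f ⋆ (g ⋆ a)` for `a` killed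
by `ψ^N` and `p^k` (`IwasawaDual.evalT_mul` + `pow_apply_evalT_id`). [cite: Lang1990, Ch. 5 §1] -/
theorem evalT_id_mul (ψ : AddMonoid.End A) {N k : ℕ} (f g : PowerSeries ℤ_[p]) {a : A}
    (haN : (ψ ^ N) a = 0) (hak : p ^ k • a = 0) :
    evalT p ψ N k (f * g) (AddMonoidHom.id A) a =
      evalT p ψ N k f (AddMonoidHom.id A) (evalT p ψ N k g (AddMonoidHom.id A) a) := by
  rw [evalT_mul f g _ haN hak, evalT_def, evalT_def]
  refine Finset.sum_congr rfl fun i _ ↦ ?_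
  rw [AddMonoidHom.mk'_apply, AddMonoidHom.id_apply, pow_apply_evalT_id]

/-- The truncated evaluation at truncation `N` only reads the coefficients of `f` below `N`
(`Λ → ℤ_p[X]/(X^N, p^k)` factors through the truncation). [cite: Lang1990, Ch. 5 §1 Thm. 1.1] -/
theorem evalT_congr_left (ψ : AddMonoid.End A) {N k : ℕ} {f g : PowerSeries ℤ_[p]}
    (h : ∀ i < N, coeff i f = coeff i g) (x : A →+ A) (a : A) :
    evalT p ψ N k f x a = evalT p ψ N k g x a :=
  Finset.sum_congr rfl fun i hi ↦ by rw [h i (Finset.mem_range.mp hi)]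

/-- The truncated evaluation is additive in the element: finite sums (`evalT_add_right`).
[cite: Lang1990, Ch. 5 §1 Thm. 1.1] -/
theorem evalT_id_sum (ψ : AddMonoid.End A) (N k : ℕ) (f : PowerSeries ℤ_[p]) {ι : Type*}
    (s : Finset ι) (a : ι → A) :
    evalT p ψ N k f (AddMonoidHom.id A) (∑ i ∈ s, a i) =
      ∑ i ∈ s, evalT p ψ N k f (AddMonoidHom.id A) (a i) :=
  map_sum (AddMonoidHom.mk' (fun b ↦ evalT p ψ N k f (AddMonoidHom.id A) b) (evalT_add_right N k f _))
    a s

end Transport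

/-! ## Part 3. The levels along a `ℤ_p`-extension: stability of Selmer conditions and of the
transition / restriction / norm maps under `conj` -/

section Tower

variable {K : Type u} [Field K] [NumberField K] (W : WeierstrassCurve K) (p : ℕ) [Fact p.Prime]

omit [NumberField K] in
/-- `γ^{pⁿ} ∈ Gal(K̄/K_n) = κ⁻¹(pⁿ ℤ_p)` for a topological generator `γ` (`κ(γ) = 1`; local copy of
`ZpExtension.pow_mem_layerSubgroup`). [cite: GreenbergLNM1716, §1 (p. 60, `Γ_n = Γ^{pⁿ}`)] -/
theorem pow_mem_layerSubgroup (κ : ZpExtension K p) {γ : Field.absoluteGaloisGroup K}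
    (hγ : κ.IsTopGenerator γ) (n : ℕ) : γ ^ p ^ n ∈ κ.layerSubgroup n := by
  have hγ' : κ γ = Multiplicative.ofAdd 1 := hγ
  rw [ZpExtension.mem_layerSubgroup, map_pow, hγ', ← ofAdd_nsmul, toAdd_ofAdd, nsmul_eq_mul,
    mul_one, Nat.cast_pow]

variable (H : Subgroup (Field.absoluteGaloisGroup K)) [H.Normal]

/-- **Selmer conditions are `conj`-stable**: `conj_σ Sel^{(m)}(E/L) ⊆ Sel^{(m)}(E/L)` (the local
conditions are imposed at all `Γ_K`-conjugates; `conj_τ conj_σ = conj_{τσ}`).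
[cite: PerrinRiou1987BSMF, §0 p. 401] [cite: GreenbergLNM1716, §1] -/
theorem conjH1_mem_selmerTorsionOver (m : ℤ) (σ : Field.absoluteGaloisGroup K)
    {c : W.torsionH1Over m H} (hc : c ∈ W.selmerTorsionOver H m) :
    Literature.NumberTheory.EllipticCurves.conjH1 H (geomTorsion W m) σ c ∈ W.selmerTorsionOver H m := by
  simp only [selmerTorsionOver, AddSubgroup.mem_inf, AddSubgroup.mem_iInf, AddSubgroup.mem_comap,
    AddMonoidHom.mem_ker] at hc ⊢
  have hmul : ∀ τ, Literature.NumberTheory.EllipticCurves.conjH1 H (geomTorsion W m) τ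
      (Literature.NumberTheory.EllipticCurves.conjH1 H (geomTorsion W m) σ c) =
      Literature.NumberTheory.EllipticCurves.conjH1 H (geomTorsion W m) (τ * σ) c := fun τ ↦ by
    rw [Literature.NumberTheory.EllipticCurves.conjH1_mul_holds H (geomTorsion W m) τ σ]; rfl
  exact ⟨fun v τ ↦ by rw [hmul]; exact hc.1 v (τ * σ), fun w τ ↦ by rw [hmul]; exact hc.2 w (τ * σ)⟩

variable {W H}

omit [Fact p.Prime] in
/-- Every power of `ψ = conj_γ − 1` preserves the Selmer group. [cite: GreenbergLNM1716, §1] -/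
theorem psi_pow_mem_selmerTorsionOver {γ : Field.absoluteGaloisGroup K} {k : ℕ}
    {ψ : AddMonoid.End (W.torsionH1Over ((p : ℤ) ^ k) H)}
    (hψ : ∀ y, ψ y = Literature.NumberTheory.EllipticCurves.conjH1 H (geomTorsion W ((p : ℤ) ^ k)) γ y - y) (i : ℕ)
    {c : W.torsionH1Over ((p : ℤ) ^ k) H} (hc : c ∈ W.selmerTorsionOver H ((p : ℤ) ^ k)) :
    (ψ ^ i) c ∈ W.selmerTorsionOver H ((p : ℤ) ^ k) := by
  induction i generalizing c with
  | zero => exact hc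
  | succ i ih =>
    rw [pow_succ, AddMonoid.End.coe_mul, Function.comp_apply, hψ]
    exact ih (sub_mem (conjH1_mem_selmerTorsionOver W H _ γ hc) hc)

/-- The truncated action preserves the Selmer group (a sum of multiples of the `ψ^i c`).
[cite: PerrinRiou1987BSMF, §0 p. 401 ("des `ℤ_p`-modules")] -/
theorem evalT_mem_selmerTorsionOver {γ : Field.absoluteGaloisGroup K} {k : ℕ}
    {ψ : AddMonoid.End (W.torsionH1Over ((p : ℤ) ^ k) H)}
    (hψ : ∀ y, ψ y = Literature.NumberTheory.EllipticCurves.conjH1 H (geomTorsion W ((p : ℤ) ^ k)) γ y - y) (N : ℕ) (f : PowerSeries ℤ_[p])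
    {c : W.torsionH1Over ((p : ℤ) ^ k) H} (hc : c ∈ W.selmerTorsionOver H ((p : ℤ) ^ k)) :
    evalT p ψ N k f (AddMonoidHom.id _) c ∈ W.selmerTorsionOver H ((p : ℤ) ^ k) := by
  rw [evalT_def]
  refine AddSubgroup.sum_mem _ fun i _ ↦ ?_
  rw [zpT_def, AddMonoidHom.id_apply]
  exact AddSubgroup.nsmul_mem _ (psi_pow_mem_selmerTorsionOver p hψ i hc) _

variable (W H)

omit [NumberField K] [Fact p.Prime] in
/-- `p_*` commutes with `conj_σ` (both are maps of compatible pairs). [cite: PerrinRiou1987BSMF, §0 p. 401] -/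
theorem reduceTorsionH1_conjH1 (k : ℕ) (σ : Field.absoluteGaloisGroup K)
    (x : W.torsionH1Over ((p : ℤ) ^ (k + 1)) H) :
    W.reduceTorsionH1 p k H (Literature.NumberTheory.EllipticCurves.conjH1 H (geomTorsion W ((p : ℤ) ^ (k + 1))) σ x) =
      Literature.NumberTheory.EllipticCurves.conjH1 H (geomTorsion W ((p : ℤ) ^ k)) σ (W.reduceTorsionH1 p k H x) := by
  change ((W.reduceTorsionH1 p k H).comp (Literature.NumberTheory.EllipticCurves.conjH1 H (geomTorsion W ((p : ℤ) ^ (k + 1))) σ)) x =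
    ((Literature.NumberTheory.EllipticCurves.conjH1 H (geomTorsion W ((p : ℤ) ^ k)) σ).comp (W.reduceTorsionH1 p k H)) x
  congr 1
  rw [reduceTorsionH1, Literature.NumberTheory.EllipticCurves.conjH1,
    Literature.NumberTheory.EllipticCurves.conjH1, resH1Hom_comp, resH1Hom_comp]
  refine resH1Hom_congr (by ext; simp) ?_ _ _
  ext P
  simp only [AddMonoidHom.coe_comp, Function.comp_apply, DistribSMul.toAddMonoidHom_apply,
    coe_geomTorsionReduce, Literature.NumberTheory.EllipticCurves.AddSubgroup.torsionBy.coe_smul,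
    smul_zsmul_geomPoints]

variable {W H}

omit [NumberField K] [Fact p.Prime] in
/-- `p_*` commutes with `ψ = conj_γ − 1`. [cite: PerrinRiou1987BSMF, §0 p. 401] -/
theorem reduceTorsionH1_psi {γ : Field.absoluteGaloisGroup K} {k : ℕ}
    {ψ₁ : AddMonoid.End (W.torsionH1Over ((p : ℤ) ^ (k + 1)) H)}
    {ψ₀ : AddMonoid.End (W.torsionH1Over ((p : ℤ) ^ k) H)}
    (hψ₁ : ∀ y, ψ₁ y = Literature.NumberTheory.EllipticCurves.conjH1 H (geomTorsion W ((p : ℤ) ^ (k + 1))) γ y - y)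
    (hψ₀ : ∀ y, ψ₀ y = Literature.NumberTheory.EllipticCurves.conjH1 H (geomTorsion W ((p : ℤ) ^ k)) γ y - y)
    (x : W.torsionH1Over ((p : ℤ) ^ (k + 1)) H) :
    W.reduceTorsionH1 p k H (ψ₁ x) = ψ₀ (W.reduceTorsionH1 p k H x) := by
  rw [hψ₁, hψ₀, map_sub, reduceTorsionH1_conjH1]

omit [NumberField K] [Fact p.Prime] in
/-- `res` commutes with `ψ = conj_γ − 1` (`resOfLe_comp_conjH1`). [cite: NeukirchSchmidtWingberg2008, I.§5] -/
theorem resOfLe_psi {H' : Subgroup (Field.absoluteGaloisGroup K)} [H'.Normal] (h : H ≤ H')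
    {γ : Field.absoluteGaloisGroup K} {k : ℕ}
    {ψ' : AddMonoid.End (W.torsionH1Over ((p : ℤ) ^ k) H')}
    {ψ : AddMonoid.End (W.torsionH1Over ((p : ℤ) ^ k) H)}
    (hψ' : ∀ y, ψ' y = Literature.NumberTheory.EllipticCurves.conjH1 H' (geomTorsion W ((p : ℤ) ^ k)) γ y - y)
    (hψ : ∀ y, ψ y = Literature.NumberTheory.EllipticCurves.conjH1 H (geomTorsion W ((p : ℤ) ^ k)) γ y - y)
    (x : W.torsionH1Over ((p : ℤ) ^ k) H') :
    Literature.NumberTheory.EllipticCurves.resOfLe (geomTorsion W ((p : ℤ) ^ k)) h (ψ' x) =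
      ψ (Literature.NumberTheory.EllipticCurves.resOfLe (geomTorsion W ((p : ℤ) ^ k)) h x) := by
  rw [hψ', hψ, map_sub]
  congr 1
  exact DFunLike.congr_fun (resOfLe_comp_conjH1_holds (M := geomTorsion W ((p : ℤ) ^ k)) h γ) x

omit [NumberField K] [Fact p.Prime] in
/-- `conj_σ` commutes with `ψ = conj_γ − 1` when `σ` commutes with `γ` (e.g. `σ = γ^j`).
[cite: NeukirchSchmidtWingberg2008, I.§5] -/
theorem conjH1_psi_of_commute {σ γ : Field.absoluteGaloisGroup K} (hc : Commute σ γ) {k : ℕ}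
    {ψ : AddMonoid.End (W.torsionH1Over ((p : ℤ) ^ k) H)}
    (hψ : ∀ y, ψ y = Literature.NumberTheory.EllipticCurves.conjH1 H (geomTorsion W ((p : ℤ) ^ k)) γ y - y)
    (x : W.torsionH1Over ((p : ℤ) ^ k) H) :
    Literature.NumberTheory.EllipticCurves.conjH1 H (geomTorsion W ((p : ℤ) ^ k)) σ (ψ x) = ψ (Literature.NumberTheory.EllipticCurves.conjH1 H (geomTorsion W ((p : ℤ) ^ k)) σ x) := by
  rw [hψ, hψ, map_sub]
  congr 1
  change ((Literature.NumberTheory.EllipticCurves.conjH1 H (geomTorsion W ((p : ℤ) ^ k)) σ).comp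
      (Literature.NumberTheory.EllipticCurves.conjH1 H (geomTorsion W ((p : ℤ) ^ k)) γ)) x =
    ((Literature.NumberTheory.EllipticCurves.conjH1 H (geomTorsion W ((p : ℤ) ^ k)) γ).comp
      (Literature.NumberTheory.EllipticCurves.conjH1 H (geomTorsion W ((p : ℤ) ^ k)) σ)) x
  rw [← Literature.NumberTheory.EllipticCurves.conjH1_mul_holds H (geomTorsion W ((p : ℤ) ^ k)) σ γ,
    ← Literature.NumberTheory.EllipticCurves.conjH1_mul_holds H (geomTorsion W ((p : ℤ) ^ k)) γ σ, hc.eq]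

end Tower

end LambdaAdicSelmerDataExists

end WeierstrassCurve

end
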